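import Literature.NumberTheory.PAdicHodge.UnitRootFrameEtaHom
import Literature.NumberTheory.PAdicHodge.UnitRootFrameKTwo
import Literature.NumberTheory.PAdicHodge.LineDatumPeriodHom
import Literature.NumberTheory.PAdicHodge.TatePairingPointOfKTwoBasis
import HarnessLib

/-!
# Kato's explicit reciprocity law at a completion in the UNIT-ROOT FRAME (ordinary reduction), modulo the per-point Kummer package

Topic `Literature/NumberTheory/PAdicHodge`; THEOREMS ONLY. The ORDINARY twin of `BmaxPlusTransportedReciprocity` /
`…ReciprocityFormalPoint` (line `kato_lever`, crux K★ `stmt-BirchSwinnertonDyer-22226`, stub `stub_localFormulaOrdinaryCells`; memo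
`Cruxes/StarredOptimalManinUnitFiveSeven/Lines/kato-lever-seam-rec-at-cells.md` §17 «UNIT-ROOT FRAME»).

Setting: `F = K_v`, `W/K₀` an elliptic curve with `K₀ → F`, an alternating non-degenerate Weil tower `e`, `ψ = log χ`, the de Rham binders
`hinj / hde / d` of the cell. The UNIT-ROOT FRAME is the data
* `w₀ ∈ T_pW`, `w₀ ≠ 0`, on which `Γ_F` acts through a nowhere-vanishing `ρ : Γ_F → ℤ_p` (the generator of `T_pŴ`, `FormalTateModuleRankOne`);
* `α, π ∈ ℤ_p`, `απ = p`, and a unit `u ∈ A_max` with `φu = αu` (`UnitRootPeriodWitt`);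
* a crystalline period `x ∈ B_max⁺` of `w₀`: Honda relation `φ²x − (α+π)φx + px = 0` and `σx = ρ(σ)x`;
* a Hodge pair `(A, B)`: `θ(ι(A)f x + ι(B)f φx) = 0`, `H₀ := ι(A)f x + ι(B)f φx ≠ 0`; and `ρ ≠ χ` somewhere.

* `exists_eq_embBdRHom_mul_of_isotypic` — two `ρ`-ISOTYPIC vectors of `B_dR⁺(F)` are `F`-proportional (Fontaine: `(Frac B_dR)^{Γ_F} = F`).
* ★★★ `exists_const_tatePairingPoint_eq_neg_trace_unitRootFrame` — in the unit-root frame there is ONE `c ∈ F` such that for every cocycle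
  `η`, every point `P ∈ E(F)` and every Kummer cocycle `κ` of `P` VALUED IN `ℤ_p·w₀` (`κ(σ) = k(σ)•w₀`) with a crystalline Kummer integral
  `Λ ∈ B_max⁺` (Honda relation, `σΛ = Λ + k(σ)·x`) and `θ(ι(A)fΛ + ι(B)fφΛ) = c_P`:  **`⟨[η], P⟩ = −Tr_{F/ℚ_p}(c_P · exp*_d(η) · c)`.**

Proof: feed `TatePairingPointOfKTwoBasis.exists_const_tatePairingPoint_eq_neg_trace_of_KTwoBasis` with `Pω` := the `ω`-period hom of the
line datum (`LineDatumPeriodHom`), `Pη := ē·f(u)` (`UnitRootFrameEtaHom`, vanishing on `ℤ_p w₀`), `b_η := 0`, `b_ω := ι(γ)·H_P` where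
`Pω(w₀) = ι(γ)·H₀` (both `ρ`-isotypic) and `H_P := ι(A)fΛ + ι(B)fφΛ` (`σH_P − H_P = k(σ)H₀`); (K₂) on a basis `bᵢ`: by the LEGENDRE RELATION at
`(w₀, bᵢ)` (`Pη(w₀) = 0`) the `F`-constants cancel, `x̃(bᵢ)·H₀ = e₀·t·H_P` with `e₀ = log_ε e_∞(w₀, bᵢ) ∈ ℤ_p`, and `UnitRootFrameKTwo` applies.

HONEST LIMITS: the per-point Kummer package (formal `[p]`-division tower of a deep formal point at ORDINARY reduction, its `T`-adic Kummer
cocycle through `ι : T_pŴ ↪ T_pE`, the transported integral `Λ_{Tu}` and `θ(H_P) = p^N·log_{W_D}(z P)`), the frame itself (`x = LT(v₀) ≠ 0`,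
`H₀ ≠ 0`, `‖a_p‖ = 1`) and the three K★ cells are NOT in this file; BSD / K★ / [REC-tower] are NOT proved here.

## References
* K. Kato, LNM 1553 (1993), Ch. II §1.4 (1.4.2), Thm. 1.4.1 (3)–(4), Lemma 1.4.3. [Kato1993LNM1553]
* S. Bloch, K. Kato (1990), Ex. 3.10.1, Example 3.11. [BlochKato1990]
* J. Tate, *p-divisible groups* (1967), §4. [Tate1967]
* J.-M. Fontaine, Astérisque 223 (1994), Exp. II §1.5, Exp. III §1.4. [FontaineAsterisque223III]
-/

noncomputable section

open Field Function ValuativeRel WittVector NumberField IsDedekindDomain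
open scoped NumberField Topology

namespace Literature.NumberTheory.PAdicHodge

open Literature.NumberTheory.GaloisRepresentations
open Literature.NumberTheory.GaloisRepresentations.IsNonarchimedeanLocalField
open Literature.NumberTheory.GaloisCohomology
open Literature.NumberTheory.EllipticCurves
open Literature.NumberTheory.PAdicHodge.GaloisContinuity
open _root_.WeierstrassCurve

/-! ## §1 Isotypic vectors of `B_dR⁺` are `F`-proportional -/

section Isotypic

variable {F : Type} [Field F] [ValuativeRel F] [TopologicalSpace F] [IsNonarchimedeanLocalField F] [CharZero F]
  {p : ℕ} [Fact p.Prime] [Fact (¬ IsUnit (p : integerC F))] [IsAdicComplete (Ideal.span {(p : integerC F)}) (integerC F)]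

/-- **Two `r`-isotypic vectors of `B_dR⁺(F)` are `F`-proportional**: if `σb = r(σ)b`, `σc = r(σ)c` for all `σ ∈ Γ_F` and `c ≠ 0` then
`b = ι(γ)·c` for some `γ ∈ F` (`b/c ∈ (Frac B_dR)^{Γ_F} = F`, Fontaine). [cite: FontaineAsterisque223III, Exp. III §1.4] -/
theorem exists_eq_embBdRHom_mul_of_isotypic (hp : valuation F p < 1) (hF : Function.Surjective (fontaineTheta (integerC F) p))
    {b c : BDeRhamPlus (integerC F) p} (hc : c ≠ 0) (r : absoluteGaloisGroup F → BDeRhamPlus (integerC F) p)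
    (hb : ∀ σ, galBdRPlus σ b = r σ * b) (hc' : ∀ σ, galBdRPlus σ c = r σ * c) :
    ∃ γ : F, b = embBdRHom hp hF γ * c := by
  haveI : IsDomain (BDeRhamPlus (integerC F) p) := isDomain_bDeRhamPlus hF
  have hinj := algebraMap_fracBdR_injective (F := F) (p := p)
  have hC : algebraMap (BDeRhamPlus (integerC F) p) (FracBdR F p) c ≠ 0 := fun h0 => hc (hinj (by rw [h0, map_zero]))
  obtain ⟨γ, hγ⟩ := exists_smul_eq_fracBdR hp hF (algebraMap _ (FracBdR F p) b) (algebraMap _ (FracBdR F p) c) hC (fun σ => by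
    rw [smul_algebraMap_fracBdR, smul_algebraMap_fracBdR, ← map_mul, ← map_mul, hb, hc']
    congr 1; ring)
  refine ⟨γ, hinj ?_⟩
  rw [hγ]
  letI := fracAlgebra (p := p) hp hF
  change γ • algebraMap (BDeRhamPlus (integerC F) p) (FracBdR F p) c = _
  rw [Algebra.smul_def, algebraMap_fracAlgebra, ← map_mul]

/-- The same in `BdRPlusTop` form: two `r`-isotypic vectors `b, c ≠ 0` of `B_dR⁺(F)` satisfy `b = ι(γ)·c`, `γ ∈ F`.
[cite: FontaineAsterisque223III, Exp. III §1.4] -/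
theorem exists_eq_of_embBdRHom_mul_of_isotypic (hp : valuation F p < 1) (hF : Function.Surjective (fontaineTheta (integerC F) p))
    {b c : BdRPlusTop F p} (hc : c ≠ 0) (r : absoluteGaloisGroup F → BdRPlusTop F p)
    (hb : ∀ σ, BdRPlusTop.gal F p σ b = r σ * b) (hc' : ∀ σ, BdRPlusTop.gal F p σ c = r σ * c) :
    ∃ γ : F, b = BdRPlusTop.of F p (embBdRHom hp hF γ) * c := by
  obtain ⟨b', rfl⟩ := (BdRPlusTop.of F p).surjective b
  obtain ⟨c', rfl⟩ := (BdRPlusTop.of F p).surjective c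
  have hc0 : c' ≠ 0 := fun h0 => hc (by rw [h0, map_zero])
  choose r' hr' using fun σ => (BdRPlusTop.of F p).surjective (r σ)
  obtain ⟨γ, hγ⟩ := exists_eq_embBdRHom_mul_of_isotypic hp hF hc0 r'
    (fun σ => (BdRPlusTop.of F p).injective (by rw [← BdRPlusTop.gal_of, hb, ← hr', map_mul]))
    (fun σ => (BdRPlusTop.of F p).injective (by rw [← BdRPlusTop.gal_of, hc', ← hr', map_mul]))
  exact ⟨γ, by rw [hγ, map_mul]⟩

set_option maxHeartbeats 1600000 in
set_option synthInstance.maxHeartbeats 400000 in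
/-- **Galois on crystalline images**: `σ(f y) = f(σ y)` and `σ(f φy) = f(φ(σ y))`, read for `σy = ι(c)y` resp. `σy = y + ι(c)x`
(`σ` commutes with `φ`, `φ` fixes `ι(ℤ_p)`). [cite: FontaineAsterisque223III, Exp. II §1.5] -/
theorem galBdRPlus_bmaxPlusToBdR_frob_of_gal_eq (σ : absoluteGaloisGroup F) {y z : BmaxPlus F p} (hy : galBmaxPlus σ y = z) :
    galBdRPlus σ (bmaxPlusToBdR F p y) = bmaxPlusToBdR F p z ∧
      galBdRPlus σ (bmaxPlusToBdR F p (frobBmaxPlus F p y)) = bmaxPlusToBdR F p (frobBmaxPlus F p z) := by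
  refine ⟨by rw [galBdRPlus_bmaxPlusToBdR, hy], by rw [galBdRPlus_bmaxPlusToBdR, galBmaxPlus_frobBmaxPlus, hy]⟩

set_option maxHeartbeats 1600000 in
set_option synthInstance.maxHeartbeats 400000 in
/-- `φ(ι(c)) = ι(c)` read through `f`: `f(φ(ι(c)·y)) = ι(c)·f(φy)` and `f(φ(y + ι(c)x)) = f φy + ι(c) f φx`. [cite: FontaineOuyang2022, §6.1] -/
theorem bmaxPlusToBdR_frob_zp_mul (c : ℤ_[p]) (x y : BmaxPlus F p) :
    bmaxPlusToBdR F p (frobBmaxPlus F p (ainfToBmaxPlus F p (zpToAinf c) * y)) = qpToBdR (c : ℚ_[p]) * bmaxPlusToBdR F p (frobBmaxPlus F p y) ∧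
      bmaxPlusToBdR F p (frobBmaxPlus F p (y + ainfToBmaxPlus F p (zpToAinf c) * x)) =
        bmaxPlusToBdR F p (frobBmaxPlus F p y) + qpToBdR (c : ℚ_[p]) * bmaxPlusToBdR F p (frobBmaxPlus F p x) := by
  have hφc : frobBmaxPlus F p (ainfToBmaxPlus F p (zpToAinf c)) = ainfToBmaxPlus F p (zpToAinf c) := by
    rw [frobBmaxPlus_ainfToBmaxPlus, frobenius_zpToAinf]
  refine ⟨by rw [map_mul, hφc, map_mul, bmaxPlusToBdR_ainfToBmaxPlus_zpToAinf], ?_⟩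
  rw [map_add, map_mul, hφc, map_add, map_mul, bmaxPlusToBdR_ainfToBmaxPlus_zpToAinf]

set_option maxHeartbeats 3200000 in
set_option synthInstance.maxHeartbeats 400000 in
/-- **The Hodge combination `H₀ = ι(A)fx + ι(B)fφx` of a `ρ`-isotypic crystalline vector is `ρ`-isotypic** (`σ` commutes with `φ` and fixes
`ι(F)`). [cite: FontaineAsterisque223III, Exp. II §1.5] -/
theorem galBdRPlus_hodgeCombination (hp : valuation F p < 1) (hF : Function.Surjective (fontaineTheta (integerC F) p)) {x : BmaxPlus F p}
    (ρ : absoluteGaloisGroup F → ℤ_[p]) (hρx : ∀ σ, galBmaxPlus σ x = ainfToBmaxPlus F p (zpToAinf (ρ σ)) * x) (A B : F)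
    (σ : absoluteGaloisGroup F) :
    galBdRPlus σ (embBdRHom hp hF A * bmaxPlusToBdR F p x + embBdRHom hp hF B * bmaxPlusToBdR F p (frobBmaxPlus F p x)) =
      qpToBdR ((ρ σ : ℤ_[p]) : ℚ_[p]) * (embBdRHom hp hF A * bmaxPlusToBdR F p x + embBdRHom hp hF B * bmaxPlusToBdR F p (frobBmaxPlus F p x)) := by
  have h12 := galBdRPlus_bmaxPlusToBdR_frob_of_gal_eq (F := F) (p := p) σ (hρx σ)
  obtain ⟨e1, e2⟩ := h12
  have h3 := bmaxPlusToBdR_frob_zp_mul (F := F) (p := p) (ρ σ) x x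
  obtain ⟨e3, -⟩ := h3
  rw [map_mul, bmaxPlusToBdR_ainfToBmaxPlus_zpToAinf] at e1
  rw [e3] at e2
  rw [map_add, map_mul, map_mul, galBdRPlus_embBdRHom, galBdRPlus_embBdRHom, e1, e2]
  ring

set_option maxHeartbeats 1600000 in
set_option synthInstance.maxHeartbeats 400000 in
/-- The same in `BdRPlusTop` form. [cite: FontaineAsterisque223III, Exp. II §1.5] -/
theorem gal_of_hodgeCombination (hp : valuation F p < 1) (hF : Function.Surjective (fontaineTheta (integerC F) p)) {x : BmaxPlus F p}
    (ρ : absoluteGaloisGroup F → ℤ_[p]) (hρx : ∀ σ, galBmaxPlus σ x = ainfToBmaxPlus F p (zpToAinf (ρ σ)) * x) (A B : F)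
    (σ : absoluteGaloisGroup F) :
    BdRPlusTop.gal F p σ (BdRPlusTop.of F p (embBdRHom hp hF A * bmaxPlusToBdR F p x + embBdRHom hp hF B * bmaxPlusToBdR F p (frobBmaxPlus F p x))) =
      BdRPlusTop.of F p (qpToBdR ((ρ σ : ℤ_[p]) : ℚ_[p])) *
        BdRPlusTop.of F p (embBdRHom hp hF A * bmaxPlusToBdR F p x + embBdRHom hp hF B * bmaxPlusToBdR F p (frobBmaxPlus F p x)) := by
  rw [BdRPlusTop.gal_of, galBdRPlus_hodgeCombination hp hF ρ hρx A B σ, map_mul]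

set_option maxHeartbeats 3200000 in
set_option synthInstance.maxHeartbeats 400000 in
/-- **The integrating element `b_ω = ι(γ)·H_P` is a coboundary lift**: `σ(ι(γ)H_P) − ι(γ)H_P = k(σ)·ι(γ)H₀` when `σΛ = Λ + k(σ)x`
(`H_P = ι(A)fΛ + ι(B)fφΛ`). [cite: Kato1993LNM1553, Ch. II §1.4] [cite: BlochKato1990, Example 3.11] -/
theorem galBdRPlus_integratingElement_sub (hp : valuation F p < 1) (hF : Function.Surjective (fontaineTheta (integerC F) p))
    {x Λ : BmaxPlus F p} (k : absoluteGaloisGroup F → ℤ_[p]) (hgalΛ : ∀ σ, galBmaxPlus σ Λ = Λ + ainfToBmaxPlus F p (zpToAinf (k σ)) * x)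
    (A B γ : F) (τ : absoluteGaloisGroup F) :
    galBdRPlus τ (embBdRHom hp hF γ * (embBdRHom hp hF A * bmaxPlusToBdR F p Λ + embBdRHom hp hF B * bmaxPlusToBdR F p (frobBmaxPlus F p Λ))) -
      embBdRHom hp hF γ * (embBdRHom hp hF A * bmaxPlusToBdR F p Λ + embBdRHom hp hF B * bmaxPlusToBdR F p (frobBmaxPlus F p Λ)) =
      qpToBdR ((k τ : ℤ_[p]) : ℚ_[p]) * (embBdRHom hp hF γ *
        (embBdRHom hp hF A * bmaxPlusToBdR F p x + embBdRHom hp hF B * bmaxPlusToBdR F p (frobBmaxPlus F p x))) := by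
  have h12 := galBdRPlus_bmaxPlusToBdR_frob_of_gal_eq (F := F) (p := p) τ (hgalΛ τ)
  obtain ⟨e1, e2⟩ := h12
  have h3 := bmaxPlusToBdR_frob_zp_mul (F := F) (p := p) (k τ) x Λ
  obtain ⟨-, e3⟩ := h3
  rw [map_add, map_mul, bmaxPlusToBdR_ainfToBmaxPlus_zpToAinf] at e1
  rw [e3] at e2
  rw [map_mul, galBdRPlus_embBdRHom, map_add, map_mul, map_mul, galBdRPlus_embBdRHom, galBdRPlus_embBdRHom, e1, e2]
  ring

set_option maxHeartbeats 1600000 in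
set_option synthInstance.maxHeartbeats 400000 in
/-- The same in `BdRPlusTop` form. [cite: Kato1993LNM1553, Ch. II §1.4] -/
theorem gal_of_integratingElement_sub (hp : valuation F p < 1) (hF : Function.Surjective (fontaineTheta (integerC F) p))
    {x Λ : BmaxPlus F p} (k : absoluteGaloisGroup F → ℤ_[p]) (hgalΛ : ∀ σ, galBmaxPlus σ Λ = Λ + ainfToBmaxPlus F p (zpToAinf (k σ)) * x)
    (A B γ : F) (τ : absoluteGaloisGroup F) :
    BdRPlusTop.gal F p τ (BdRPlusTop.of F p (embBdRHom hp hF γ *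
        (embBdRHom hp hF A * bmaxPlusToBdR F p Λ + embBdRHom hp hF B * bmaxPlusToBdR F p (frobBmaxPlus F p Λ)))) -
      BdRPlusTop.of F p (embBdRHom hp hF γ *
        (embBdRHom hp hF A * bmaxPlusToBdR F p Λ + embBdRHom hp hF B * bmaxPlusToBdR F p (frobBmaxPlus F p Λ))) =
      BdRPlusTop.of F p (qpToBdR ((k τ : ℤ_[p]) : ℚ_[p])) * (BdRPlusTop.of F p (embBdRHom hp hF γ) *
        BdRPlusTop.of F p (embBdRHom hp hF A * bmaxPlusToBdR F p x + embBdRHom hp hF B * bmaxPlusToBdR F p (frobBmaxPlus F p x))) := by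
  rw [BdRPlusTop.gal_of, ← map_sub, galBdRPlus_integratingElement_sub hp hF k hgalΛ A B γ τ, map_mul, map_mul]

set_option maxHeartbeats 1600000 in
set_option synthInstance.maxHeartbeats 400000 in
/-- `θ(ι(γ)·H) = γ·θ(H)`. [cite: FontaineAsterisque223III, Exp. II §1.5] -/
theorem thetaBdR_of_symm_of_embBdRHom_mul (hp : valuation F p < 1) (hF : Function.Surjective (fontaineTheta (integerC F) p)) (γ : F)
    {H : BDeRhamPlus (integerC F) p} {cP : F} (hcP : thetaBdR H = algebraMap F (CompletedAlgClosure F) cP) :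
    thetaBdR ((BdRPlusTop.of F p).symm (BdRPlusTop.of F p (embBdRHom hp hF γ * H))) = algebraMap F (CompletedAlgClosure F) (γ * cP) := by
  rw [RingEquiv.symm_apply_apply, map_mul, thetaBdR_embBdRHom, hcP, map_mul]

set_option maxHeartbeats 1600000 in
set_option synthInstance.maxHeartbeats 400000 in
/-- Lifting (K₂) from `p^M` to `p^N`, `M ≤ N`, in the shape the capstone consumes (`b_η = 0`). [cite: FontaineOuyang2022, §6.1] -/
theorem isTeichLog_of_symm_resolution_of_le {X₁ X₂ X₃ : BDeRhamPlus (integerC F) p} {qa Y Z : BdRPlusTop F p} {M N : ℕ}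
    (hT : IsTeichLog 2 ((p : BDeRhamPlus (integerC F) p) ^ M * (X₁ * X₂ * X₃))) (hMN : M ≤ N) (hqa : qa = BdRPlusTop.of F p X₂) :
    IsTeichLog 2 ((BdRPlusTop.of F p).symm ((p : BdRPlusTop F p) ^ N *
      (BdRPlusTop.of F p X₁ * qa * BdRPlusTop.of F p X₃ - Y * (Z * 0)))) := by
  obtain ⟨j, rfl⟩ := exists_add_of_le hMN
  rw [hqa, mul_zero, mul_zero, sub_zero, ← map_mul, ← map_mul,
    show (p : BdRPlusTop F p) = BdRPlusTop.of F p (p : BDeRhamPlus (integerC F) p) by rw [map_natCast], ← map_pow, ← map_mul,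
    RingEquiv.symm_apply_apply, pow_add, mul_comm ((p : BDeRhamPlus (integerC F) p) ^ M), mul_assoc, ← Nat.cast_pow]
  exact hT.natCast_mul (p ^ j)

set_option maxHeartbeats 3200000 in
set_option synthInstance.maxHeartbeats 400000 in
/-- ★★ **(K₂) in the unit-root frame, from the Legendre relation at `(w₀, a)`.** With `Pω(w₀) = ι(γ)H₀`, `Pη(a) = ē(a)·f(u)`, `Pη(w₀) = 0`,
the Legendre relation reads `ι(γ)H₀·ē(a)f(u) = ι(c_L)·log[ε]^{e(w₀,a)}`; hence `x̃(a)·H₀ = e₀·t·H_P` for the rescaled resolution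
`x̃(a) = ι(c_L⁻¹)·ē(a)f(u)·ι(γ)H_P`, and `UnitRootFrameKTwo` gives `p^M x̃(a) ∈ X⁰₂ + Fil²`.
[cite: Kato1993LNM1553, Ch. II §1.4 (1.4.2) and Lemma 1.4.3] [cite: BlochKato1990, Ex. 3.10.1] -/
theorem exists_isTeichLog_frameResolution (hp : valuation F p < 1) (hF : Function.Surjective (fontaineTheta (integerC F) p))
    {α π : ℤ_[p]} (hαπ : α * π = p) {u : BmaxPlus F p} (hu : IsUnit u)
    (hφu : frobBmaxPlus F p u = ainfToBmaxPlus F p (zpToAinf α) * u) {x : BmaxPlus F p}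
    (hx : frobBmaxPlus F p (frobBmaxPlus F p x) - ainfToBmaxPlus F p (zpToAinf (α + π)) * frobBmaxPlus F p x + (p : BmaxPlus F p) * x = 0)
    (ρ : absoluteGaloisGroup F → ℤ_[p]) (hρ : ∀ σ, galBmaxPlus σ x = ainfToBmaxPlus F p (zpToAinf (ρ σ)) * x)
    {A B : F} (hfil : thetaBdR (embBdRHom hp hF A * bmaxPlusToBdR F p x + embBdRHom hp hF B * bmaxPlusToBdR F p (frobBmaxPlus F p x)) = 0)
    (hne : embBdRHom hp hF A * bmaxPlusToBdR F p x + embBdRHom hp hF B * bmaxPlusToBdR F p (frobBmaxPlus F p x) ≠ 0)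
    (hρχ : ∃ σ₁, ρ σ₁ ≠ ((GaloisRep.cyclotomicCharacter F p σ₁ : ℤ_[p]ˣ) : ℤ_[p]))
    {Λ : BmaxPlus F p}
    (hΛ : frobBmaxPlus F p (frobBmaxPlus F p Λ) - ainfToBmaxPlus F p (zpToAinf (α + π)) * frobBmaxPlus F p Λ + (p : BmaxPlus F p) * Λ = 0)
    (kum : absoluteGaloisGroup F → ℤ_[p]) (hgalΛ : ∀ σ, galBmaxPlus σ Λ = Λ + ainfToBmaxPlus F p (zpToAinf (kum σ)) * x)
    (γ cL : F) (hcL : cL ≠ 0) (eb : ℤ_[p]) (ζ : (muPadicSystem F p).limit) {pw pa qw qa : BdRPlusTop F p}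
    (hL : pw * qa - qw * pa = BdRPlusTop.of F p (embBdRHom hp hF cL) * BdRPlusTop.periodLine F p ζ) (hqw : qw = 0)
    (hpw : pw = BdRPlusTop.of F p (embBdRHom hp hF γ) *
      BdRPlusTop.of F p (embBdRHom hp hF A * bmaxPlusToBdR F p x + embBdRHom hp hF B * bmaxPlusToBdR F p (frobBmaxPlus F p x)))
    (hqa : qa = BdRPlusTop.of F p (qpToBdR ((eb : ℤ_[p]) : ℚ_[p]) * bmaxPlusToBdR F p u)) :
    ∃ M : ℕ, IsTeichLog 2 ((p : BDeRhamPlus (integerC F) p) ^ M *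
      (embBdRHom hp hF cL⁻¹ * (qpToBdR ((eb : ℤ_[p]) : ℚ_[p]) * bmaxPlusToBdR F p u) * (embBdRHom hp hF γ *
        (embBdRHom hp hF A * bmaxPlusToBdR F p Λ + embBdRHom hp hF B * bmaxPlusToBdR F p (frobBmaxPlus F p Λ))))) := by
  haveI : IsDomain (BDeRhamPlus (integerC F) p) := isDomain_bDeRhamPlus hF
  obtain ⟨e₀, rfl⟩ := (epsLineEquiv F p).surjective ζ
  rw [hqw, zero_mul, sub_zero, hpw, hqa, BdRPlusTop.periodLine_epsLineEquiv, ← map_mul, ← map_mul, ← map_mul] at hL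
  have hL' := (BdRPlusTop.of F p).injective hL
  have hH₀' : ∃ y, y = embBdRHom hp hF A * bmaxPlusToBdR F p x + embBdRHom hp hF B * bmaxPlusToBdR F p (frobBmaxPlus F p x) := ⟨_, rfl⟩
  obtain ⟨H₀, hH₀⟩ := hH₀'
  have hHP' : ∃ y, y = embBdRHom hp hF A * bmaxPlusToBdR F p Λ + embBdRHom hp hF B * bmaxPlusToBdR F p (frobBmaxPlus F p Λ) := ⟨_, rfl⟩
  obtain ⟨HP, hHP⟩ := hHP'
  have hcLinv : embBdRHom hp hF cL⁻¹ * embBdRHom hp hF cL = 1 := by rw [← map_mul, inv_mul_cancel₀ hcL, map_one]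
  refine exists_isTeichLog_pow_mul_of_mul_hodgePair_eq hF hp hαπ hu hφu hx ρ hρ hfil hne hρχ hΛ kum hgalΛ e₀ ?_
  rw [← hH₀] at hL'
  rw [← hH₀, ← hHP]
  have hXH : embBdRHom hp hF cL⁻¹ * (qpToBdR ((eb : ℤ_[p]) : ℚ_[p]) * bmaxPlusToBdR F p u) * (embBdRHom hp hF γ * HP) * H₀ =
      embBdRHom hp hF cL⁻¹ * (embBdRHom hp hF γ * H₀ * (qpToBdR ((eb : ℤ_[p]) : ℚ_[p]) * bmaxPlusToBdR F p u)) * HP := by ring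
  rw [hXH, hL']
  linear_combination (qpToBdR ((e₀ : ℤ_[p]) : ℚ_[p]) * tBdR * HP) * hcLinv

end Isotypic

/-! ## §2 The reciprocity law in the unit-root frame -/

section Completion

variable {K : Type} [Field K] [NumberField K] {p : ℕ} [hprime : Fact p.Prime] (v : HeightOneSpectrum (𝓞 K))
  [CharZero (v.adicCompletion K)] [LocallyCompactSpace (absoluteGaloisGroup (v.adicCompletion K))]
  [Fact (¬ IsUnit (p : integerC (v.adicCompletion K)))]
  [IsAdicComplete (Ideal.span {(p : integerC (v.adicCompletion K))}) (integerC (v.adicCompletion K))]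
  {K₀ : Type} [Field K₀] [CharZero K₀] (W : WeierstrassCurve K₀) [W.IsElliptic] [Algebra K₀ (v.adicCompletion K)]
  (e : (k : ℕ) → geomTorsion W ((p ^ k : ℕ) : ℤ) → geomTorsion W ((p ^ k : ℕ) : ℤ) → AlgebraicClosure K₀)
  (hμ : ∀ k S T, e k S T ^ (p ^ k) = 1) (hadd₁ : ∀ k S₁ S₂ T, e k (S₁ + S₂) T = e k S₁ T * e k S₂ T)
  (hadd₂ : ∀ k S T₁ T₂, e k S (T₁ + T₂) = e k S T₁ * e k S T₂)
  (hgal : ∀ k (σ : absoluteGaloisGroup K₀) (S T : geomTorsion W ((p ^ k : ℕ) : ℤ)), σ • e k S T = e k (σ • S) (σ • T))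
  (hcompat : ∀ k (S T : geomTorsion W ((p ^ (k + 1) : ℕ) : ℤ)),
    e k (torsionMulHom W (p ^ (k + 1)) (p ^ k) p (pow_succ p k).symm S)
      (torsionMulHom W (p ^ (k + 1)) (p ^ k) p (pow_succ p k).symm T) = e (k + 1) S T ^ p)

set_option maxHeartbeats 6400000 in
include hgal in
/-- ★★★ **Kato's explicit reciprocity law at `F = K_v` in the UNIT-ROOT FRAME (ordinary reduction), modulo the per-point Kummer package.**
Given the cell data (`ψ = log χ`, Weil tower with `heL/healt/henondeg`, `hinj/hde/d`) and a unit-root frame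
(`w₀ ≠ 0`, `σw₀ = ρ(σ)w₀`, `ρ(σ) ≠ 0`; `απ = p`, unit `u` with `φu = αu`; `x` with `φ²x − (α+π)φx + px = 0`, `σx = ρ(σ)x`; Hodge pair
`(A, B)` with `θ(H₀) = 0`, `H₀ = ι(A)fx + ι(B)fφx ≠ 0`; `ρ ≠ χ` somewhere), there is ONE `c ∈ F` such that: for every cocycle `η`, every
`P ∈ E(F)`, every cocycle `κ` whose level classes are the Kummer classes of `P` and which is valued in `ℤ_p w₀` (`κ(σ) = k(σ)•w₀`), every
`Λ ∈ B_max⁺` with the Honda relation and `σΛ = Λ + k(σ)·x`, and every `c_P ∈ F` with `θ(ι(A)fΛ + ι(B)fφΛ) = c_P`: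
**`⟨[η], P⟩ = −Tr_{F/ℚ_p}(c_P · exp*_d(η) · c)`.** [cite: Kato1993LNM1553, Ch. II Thm. 1.4.1 (3)–(4), §1.4 (1.4.2), Lemma 1.4.3]
[cite: BlochKato1990, Example 3.11] [cite: Tate1967, §4] [cite: FontaineAsterisque223III, Exp. III §1.4] -/
theorem exists_const_tatePairingPoint_eq_neg_trace_unitRootFrame
    (hpv : valuation (v.adicCompletion K) (p : v.adicCompletion K) < 1)
    (ψ : C(absoluteGaloisGroup (v.adicCompletion K), ℤ_[p])) (hψ : ∀ σ τ, ψ (σ * τ) = ψ σ + ψ τ)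
    (hψlog : ∀ τ, (ψ τ : ℚ_[p]) = logCyclotomic (F := v.adicCompletion K) p τ)
    (heL : ∀ (c : ℤ_[p]) (S U : W.tateModule p), (weilContPairingPadic W (v.adicCompletion K) p e hμ hadd₁ hadd₂ hgal hcompat).toLin (c • S) U =
      twistHom (v.adicCompletion K) p ((weilContPairingPadic W (v.adicCompletion K) p e hμ hadd₁ hadd₂ hgal hcompat).toLin S U) c)
    (healt : ∀ S : W.tateModule p, (weilContPairingPadic W (v.adicCompletion K) p e hμ hadd₁ hadd₂ hgal hcompat).toLin S S = 0)
    (henondeg : ∀ S : W.tateModule p,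
      (∀ U, (weilContPairingPadic W (v.adicCompletion K) p e hμ hadd₁ hadd₂ hgal hcompat).toLin S U = 0) → S = 0)
    (hinj : letI := LocalField.padicAlgebra (v.adicCompletion K) p hpv
      (bdRPeriodRingData (F := v.adicCompletion K) (p := p) hpv).CupLogInjective (logCyclotomic p) (restrictedRationalTateRep W (v.adicCompletion K) p))
    (hde : letI := LocalField.padicAlgebra (v.adicCompletion K) p hpv
      ∀ η : contOneCocycles (restrictedTateRep W (v.adicCompletion K) p).toTopRep,
        (bdRPeriodRingData (F := v.adicCompletion K) (p := p) hpv).HasDualExp (logCyclotomic p) (restrictedRationalTateRep W (v.adicCompletion K) p)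
          fun σ => TateModule.toRational p (η.1 σ))
    (d : letI := LocalField.padicAlgebra (v.adicCompletion K) p hpv
      (bdRPeriodRingData (F := v.adicCompletion K) (p := p) hpv).FilZeroLine (restrictedRationalTateRep W (v.adicCompletion K) p))
    -- the unit-root frame
    {w₀ : W.tateModule p} (hw₀ : w₀ ≠ 0) (ρ : absoluteGaloisGroup (v.adicCompletion K) → ℤ_[p]) (hρ0 : ∀ σ, ρ σ ≠ 0)
    (hρw : ∀ σ, restrictedTateRep W (v.adicCompletion K) p σ w₀ = ρ σ • w₀)
    {α π : ℤ_[p]} (hαπ : α * π = p) {u : BmaxPlus (v.adicCompletion K) p} (hu : IsUnit u)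
    (hφu : frobBmaxPlus (v.adicCompletion K) p u = ainfToBmaxPlus (v.adicCompletion K) p (zpToAinf α) * u)
    {x : BmaxPlus (v.adicCompletion K) p}
    (hx : frobBmaxPlus (v.adicCompletion K) p (frobBmaxPlus (v.adicCompletion K) p x) -
      ainfToBmaxPlus (v.adicCompletion K) p (zpToAinf (α + π)) * frobBmaxPlus (v.adicCompletion K) p x + (p : BmaxPlus (v.adicCompletion K) p) * x = 0)
    (hρx : ∀ σ, galBmaxPlus σ x = ainfToBmaxPlus (v.adicCompletion K) p (zpToAinf (ρ σ)) * x)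
    {A B : v.adicCompletion K}
    (hfil : thetaBdR (embBdRHom hpv (surjective_fontaineTheta_integerC hpv) A * bmaxPlusToBdR (v.adicCompletion K) p x +
      embBdRHom hpv (surjective_fontaineTheta_integerC hpv) B * bmaxPlusToBdR (v.adicCompletion K) p (frobBmaxPlus (v.adicCompletion K) p x)) = 0)
    (hne : embBdRHom hpv (surjective_fontaineTheta_integerC hpv) A * bmaxPlusToBdR (v.adicCompletion K) p x +
      embBdRHom hpv (surjective_fontaineTheta_integerC hpv) B * bmaxPlusToBdR (v.adicCompletion K) p (frobBmaxPlus (v.adicCompletion K) p x) ≠ 0)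
    (hρχ : ∃ σ₁, ρ σ₁ ≠ ((GaloisRep.cyclotomicCharacter (v.adicCompletion K) p σ₁ : ℤ_[p]ˣ) : ℤ_[p])) :
    letI := LocalField.padicAlgebra (v.adicCompletion K) p hpv
    ∃ c : v.adicCompletion K,
      ∀ (η κ : contOneCocycles (restrictedTateRep W (v.adicCompletion K) p).toTopRep) (P : (W.baseChange (v.adicCompletion K)).toAffine.Point),
        (∀ j, (cohomologyMap (tateProjMor W (v.adicCompletion K) p j) 1).hom (oneCocycleClass _ κ) = kummerLevelClass W (v.adicCompletion K) p j P) →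
        ∀ (k : absoluteGaloisGroup (v.adicCompletion K) → ℤ_[p]), (∀ σ, κ.1 σ = (k σ • w₀ : W.tateModule p)) →
        ∀ (Λ : BmaxPlus (v.adicCompletion K) p),
          frobBmaxPlus (v.adicCompletion K) p (frobBmaxPlus (v.adicCompletion K) p Λ) -
            ainfToBmaxPlus (v.adicCompletion K) p (zpToAinf (α + π)) * frobBmaxPlus (v.adicCompletion K) p Λ +
              (p : BmaxPlus (v.adicCompletion K) p) * Λ = 0 →
          (∀ σ, galBmaxPlus σ Λ = Λ + ainfToBmaxPlus (v.adicCompletion K) p (zpToAinf (k σ)) * x) →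
          ∀ cP : v.adicCompletion K,
            thetaBdR (embBdRHom hpv (surjective_fontaineTheta_integerC hpv) A * bmaxPlusToBdR (v.adicCompletion K) p Λ +
              embBdRHom hpv (surjective_fontaineTheta_integerC hpv) B * bmaxPlusToBdR (v.adicCompletion K) p (frobBmaxPlus (v.adicCompletion K) p Λ)) =
              algebraMap (v.adicCompletion K) (CompletedAlgClosure (v.adicCompletion K)) cP →
            ((tatePairingPoint W (v.adicCompletion K) p e hμ hadd₁ hadd₂ hgal hcompat (oneCocycleClass _ η) P : ℤ_[p]) : ℚ_[p]) =
              -Algebra.trace ℚ_[p] (v.adicCompletion K) (cP * (expStarCoord W hpv d η * c)) := by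
  letI := LocalField.padicAlgebra (v.adicCompletion K) p hpv
  have hF : Function.Surjective (fontaineTheta (integerC (v.adicCompletion K)) p) := surjective_fontaineTheta_integerC hpv
  haveI : IsDomain (BDeRhamPlus (integerC (v.adicCompletion K)) p) := isDomain_bDeRhamPlus hF
  have halg : ∀ c : ℚ_[p], algebraMap ℚ_[p] (v.adicCompletion K) c = LocalField.padicRingHom (v.adicCompletion K) p hpv c := fun _ => rfl
  haveI := module_free_tateModule_holds W p
  haveI := module_finite_tateModule_holds W p
  -- `Pω` (line datum) and `Pη = ē·f(u)` (unit-root frame)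
  -- (STEPWISE applications: one-shot applications of these many-binder theorems cost a prohibitive amount of elaboration)
  have hB6 := exists_periodHom_of_filZeroLine W e hμ hadd₁ hadd₂ hgal hcompat hpv halg healt henondeg
  obtain ⟨Pω, hPωZ, hPω, hfilω, hneω, -⟩ := hB6 d
  clear hB6
  have hper := galBmaxPlus_unitRoot_mul hF hpv hαπ hu hφu hx ρ hρx hfil hne
  have hB3a := exists_etaPeriodHom_unitRoot W e hμ hadd₁ hadd₂ hgal hcompat hF heL healt henondeg hw₀ ρ hρ0 hρw hu
  obtain ⟨Pη, hPηval, hPηZ, hPη, hnotη, hPηw⟩ := hB3a hper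
  clear hB3a
  -- the capstone
  have hcap := exists_const_tatePairingPoint_eq_neg_trace_of_KTwoBasis v W e hμ hadd₁ hadd₂ hgal hcompat hpv hF ψ hψ hψlog
    (Pω := Pω) (Pη := Pη) hPωZ hPηZ hPω hPη hfilω hneω hnotη
  have hcap2 := hcap heL healt henondeg
  have hcap3 := hcap2 hinj hde d
  obtain ⟨cL, c, hcL, hLeg, hmain⟩ := hcap3
  clear hcap hcap2
  -- `Pω(w₀) = ι(γ)·H₀` (both `ρ`-isotypic, `H₀ ≠ 0`)
  have hH0ne : BdRPlusTop.of (v.adicCompletion K) p (embBdRHom hpv hF A * bmaxPlusToBdR (v.adicCompletion K) p x +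
      embBdRHom hpv hF B * bmaxPlusToBdR (v.adicCompletion K) p (frobBmaxPlus (v.adicCompletion K) p x)) ≠ 0 := fun h0 =>
    hne ((BdRPlusTop.of (v.adicCompletion K) p).injective (by rw [h0, map_zero]))
  have hgalpw : ∀ σ, BdRPlusTop.gal (v.adicCompletion K) p σ (Pω w₀) =
      BdRPlusTop.of (v.adicCompletion K) p (qpToBdR ((ρ σ : ℤ_[p]) : ℚ_[p])) * Pω w₀ := fun σ => by rw [hPω, hρw, hPωZ]
  obtain ⟨γ, hγ⟩ := exists_eq_of_embBdRHom_mul_of_isotypic hpv hF hH0ne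
    (fun σ => BdRPlusTop.of (v.adicCompletion K) p (qpToBdR ((ρ σ : ℤ_[p]) : ℚ_[p]))) hgalpw (gal_of_hodgeCombination hpv hF ρ hρx A B)
  have hPηw₀ : Pη w₀ = 0 := (congrArg Pη (one_smul ℤ_[p] w₀)).symm.trans (hPηw 1)
  refine ⟨γ * c, fun η κ P hκ k hk Λ hΛ hgalΛ cP hcP => ?_⟩
  -- the integrating pair `(b_ω, b_η) = (ι(γ)·H_P, 0)`: coboundary identities and `θ(b_ω) = γ·c_P`
  have h2 : ∀ τ, Pω (κ.1 τ) =
      BdRPlusTop.gal (v.adicCompletion K) p τ (BdRPlusTop.of (v.adicCompletion K) p (embBdRHom hpv hF γ *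
        (embBdRHom hpv hF A * bmaxPlusToBdR (v.adicCompletion K) p Λ +
          embBdRHom hpv hF B * bmaxPlusToBdR (v.adicCompletion K) p (frobBmaxPlus (v.adicCompletion K) p Λ)))) -
      BdRPlusTop.of (v.adicCompletion K) p (embBdRHom hpv hF γ *
        (embBdRHom hpv hF A * bmaxPlusToBdR (v.adicCompletion K) p Λ +
          embBdRHom hpv hF B * bmaxPlusToBdR (v.adicCompletion K) p (frobBmaxPlus (v.adicCompletion K) p Λ))) := fun τ =>
    (congrArg Pω (hk τ)).trans (((hPωZ (k τ) w₀).trans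
      (congrArg (fun y => BdRPlusTop.of (v.adicCompletion K) p (qpToBdR ((k τ : ℤ_[p]) : ℚ_[p])) * y) hγ)).trans
        (gal_of_integratingElement_sub hpv hF k hgalΛ A B γ τ).symm)
  have h3 : ∀ τ, Pη (κ.1 τ) = BdRPlusTop.gal (v.adicCompletion K) p τ 0 - 0 := fun τ =>
    (congrArg Pη (hk τ)).trans ((hPηw (k τ)).trans (by rw [map_zero, sub_zero]))
  have h4 := thetaBdR_of_symm_of_embBdRHom_mul hpv hF γ hcP
  -- (K₂) on a `ℤ_p`-basis of `T_pW`, from the Legendre relation at `(w₀, bᵢ)`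
  let b := Module.Free.chooseBasis ℤ_[p] (W.tateModule p)
  have hK := fun i => exists_isTeichLog_frameResolution hpv hF hαπ hu hφu hx ρ hρx hfil hne hρχ hΛ k hgalΛ γ cL hcL _ _
    (hLeg w₀ (b i)) hPηw₀ hγ (hPηval (b i))
  choose M hM using hK
  have hN' : ∃ N : ℕ, ∀ i, M i ≤ N := ⟨Finset.univ.sup M, fun i => Finset.le_sup (Finset.mem_univ i)⟩
  obtain ⟨N, hN⟩ := hN'
  have hres := hmain η κ P hκ _ 0 (γ * cP) h2 h3 h4 N b (fun i => isTeichLog_of_symm_resolution_of_le (hM i) (hN i) (hPηval (b i)))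
  rw [hres, show γ * cP * (expStarCoord W hpv d η * c) = cP * (expStarCoord W hpv d η * (γ * c)) by ring]

end Completion

end Literature.NumberTheory.PAdicHodge
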